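import Literature.NumberTheory.Sieve.MontgomeryVaughan1975Section7
import Literature.NumberTheory.Sieve.MontgomeryVaughan1975GaussSums
import HarnessLib

/-!
# Montgomery–Vaughan (1975), §6 part A: (6.1)–(6.4), the major-arc integral expanded by characters — PROVED

H. L. Montgomery, R. C. Vaughan, *The exceptional set in Goldbach's problem*, Acta Arith. 27
(1975) 353–370 [MontgomeryVaughanActa1975], §6, pp. 361–362. First layer of the discharge of the
named fact `section6_formulae` ((6.17), (6.1͂7)): the exact identities.

* `fourierChar_div_eq_sum_char`: `e(b/q) = φ(q)⁻¹ ∑_χ χ(b) τ(χ̄)` for `(b, q) = 1` (orthogonality);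
* `expSum_majorArc_eq` — **(6.1)**: `S(a/q + η) = φ(q)⁻¹ ∑_χ χ(a) τ(χ̄) S(χ, η)` for `(a, q) = 1`,
  `1 ≤ q ≤ P` (every prime of the window exceeds `P ≥ q`); `charExpSum_changeLevel`:
  `S(χ, η) = S(χ*, η)`;
* `sum_coprime_char_mul_fourierChar`: `∑_{1≤a≤q,(a,q)=1} χ(a) e(am/q) = c_χ(m)` (`charGauss`, (2.1));
* `disjoint_majorArc`, `majorArcIntegral_eq_sum`: for `2P < Q` the arcs `𝔐(q, a)` are pairwise
  disjoint and `R₁(n) = ∑_{q≤P} ∑'_a ∫_{𝔐(q,a)} S(α)² e(−nα) dα`; `integral_majorArc_eq`: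
  `∫_{𝔐(q,a)} F = ∫_{−1/qQ}^{1/qQ} F(a/q + η) dη`;
* `expSum_sq_mul_majorArc_eq` — **(6.3)** pointwise, and `sum_coprime_integral_expSum_sq_eq` —
  **(6.4) in general form**: `∑'_a ∫_{−h}^{h} S(a/q+η)² e(−n(a/q+η)) dη
  = φ(q)⁻² ∑_{χ,χ'} c_{χχ'}(−n) τ(χ̄) τ(χ̄') ∫_{−h}^{h} S(χ,η) S(χ',η) e(−nη) dη`
  (the printed (6.4) follows by inserting `S(χ₀,η) = T(η) + W(χ₀,η)`, `S(χ,η) = W(χ,η)`).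
-/

noncomputable section

open MeasureTheory Set Finset Real Complex
open scoped FourierTransform

namespace Literature.NumberTheory.Sieve.MontgomeryVaughan1975

/-! ### (6.1): `S(a/q + η) = φ(q)⁻¹ ∑_χ χ(a) τ(χ̄) S(χ, η)` -/

/-- **`e(b/q) = φ(q)⁻¹ ∑_χ χ(b) τ(χ̄)` for `(b, q) = 1`** (orthogonality of characters;
Montgomery–Vaughan 1975, p. 361: "if `p > P` then `(p, q) = 1`, so that
`e(pα) = φ(q)⁻¹ ∑_χ χ(pa) τ(χ̄) e(pη)`"). [cite: MontgomeryVaughanActa1975, §6 (6.1)] -/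
theorem fourierChar_div_eq_sum_char {q : ℕ} [NeZero q] {b : ℕ} (hb : b.Coprime q) :
    (𝐞 ((b : ℝ) / q) : ℂ) =
      (q.totient : ℂ)⁻¹ * ∑ χ : DirichletCharacter ℂ q, χ (b : ZMod q) * gaussSum χ⁻¹ ZMod.stdAddChar := by
  have hbu : IsUnit (b : ZMod q) := (ZMod.isUnit_iff_coprime b q).mpr hb
  have hφ : (q.totient : ℂ) ≠ 0 := by exact_mod_cast (Nat.totient_pos.mpr (NeZero.pos q)).ne'
  -- `∑_χ χ(b) τ(χ̄) = ∑_χ χ̄(b) τ(χ) = ∑_m e(m/q) ∑_χ χ(b⁻¹) χ(m) = φ(q) e(b/q)`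
  obtain ⟨u, hu⟩ := hbu
  have hinv : ∀ χ : DirichletCharacter ℂ q, χ⁻¹ (b : ZMod q) = χ (b : ZMod q)⁻¹ := by
    intro χ
    rw [MulChar.inv_apply, ← hu, Ring.inverse_unit, ZMod.inv_coe_unit]
  have hreindex : ∑ χ : DirichletCharacter ℂ q, χ (b : ZMod q) * gaussSum χ⁻¹ ZMod.stdAddChar =
      ∑ χ : DirichletCharacter ℂ q, χ⁻¹ (b : ZMod q) * gaussSum χ ZMod.stdAddChar :=
    Fintype.sum_equiv (Equiv.inv (DirichletCharacter ℂ q)) _ _ fun χ => by simp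
  have key : ∑ χ : DirichletCharacter ℂ q, χ (b : ZMod q) * gaussSum χ⁻¹ ZMod.stdAddChar =
      (q.totient : ℂ) * (𝐞 ((b : ℝ) / q) : ℂ) := by
    rw [hreindex]
    simp_rw [hinv, gaussSum, Finset.mul_sum]
    rw [Finset.sum_comm]
    have : ∀ m : ZMod q, ∑ χ : DirichletCharacter ℂ q, χ (b : ZMod q)⁻¹ * (χ m * ZMod.stdAddChar m) =
        (if (b : ZMod q) = m then (q.totient : ℂ) else 0) * ZMod.stdAddChar m := by
      intro m
      rw [← DirichletCharacter.sum_char_inv_mul_char_eq ℂ ⟨u, hu⟩ m, Finset.sum_mul]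
      refine Finset.sum_congr rfl fun χ _ => ?_
      ring
    simp_rw [this]
    simp only [ite_mul, zero_mul, Finset.sum_ite_eq, Finset.mem_univ, if_true]
    congr 1
    rw [show ((b : ℝ) / q) = ((b : ℤ) : ℝ) / q by push_cast; ring, fourierChar_div_eq_stdAddChar']
    push_cast; rfl
  rw [key, ← mul_assoc, inv_mul_cancel₀ hφ, one_mul]

/-- Primes of the window are coprime to every `1 ≤ q ≤ P`. [folklore] -/
theorem coprime_of_mem_primeWindow {P X : ℝ} {p q : ℕ} (hp : p ∈ primeWindow P X) (hq : 1 ≤ q)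
    (hqP : (q : ℝ) ≤ P) : p.Coprime q := by
  rw [mem_primeWindow] at hp
  have hprime := hp.1.2
  have hqp : q < p := by exact_mod_cast hqP.trans_lt hp.2
  exact (Nat.Prime.coprime_iff_not_dvd hprime).mpr (Nat.not_dvd_of_pos_of_lt hq hqp)


/-- **(6.1)** `S(a/q + η) = φ(q)⁻¹ ∑_χ χ(a) τ(χ̄) S(χ, η)` for `(a, q) = 1`, `1 ≤ q ≤ P`
(Montgomery–Vaughan 1975, (6.1)). [cite: MontgomeryVaughanActa1975, §6 (6.1)] -/
theorem expSum_majorArc_eq {P X : ℝ} {q : ℕ} [NeZero q] (hq : 1 ≤ q) (hqP : (q : ℝ) ≤ P) {a : ℕ}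
    (ha : a.Coprime q) (η : ℝ) :
    expSum P X ((a : ℝ) / q + η) =
      (q.totient : ℂ)⁻¹ * ∑ χ : DirichletCharacter ℂ q,
        χ (a : ZMod q) * gaussSum χ⁻¹ ZMod.stdAddChar * charExpSum P X χ η := by
  unfold expSum charExpSum
  -- expand `e(p(a/q + η)) = e(pa/q) e(pη)` and `e(pa/q)` by characters
  have hterm : ∀ p ∈ primeWindow P X, (Real.log p : ℂ) * (𝐞 (p * ((a : ℝ) / q + η)) : ℂ) =
      (q.totient : ℂ)⁻¹ * ∑ χ : DirichletCharacter ℂ q,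
        χ (a : ZMod q) * gaussSum χ⁻¹ ZMod.stdAddChar * ((Real.log p : ℂ) * χ (p : ZMod q) * (𝐞 (p * η) : ℂ)) := by
    intro p hp
    have hcop : (p * a).Coprime q := Nat.Coprime.mul_left (coprime_of_mem_primeWindow hp hq hqP) ha
    have hsplit : (𝐞 (p * ((a : ℝ) / q + η)) : ℂ) = (𝐞 (((p * a : ℕ) : ℝ) / q) : ℂ) * (𝐞 (p * η) : ℂ) := by
      rw [← Circle.coe_mul, ← AddChar.map_add_eq_mul]
      congr 2; push_cast; ring
    rw [hsplit, fourierChar_div_eq_sum_char hcop]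
    simp only [Finset.mul_sum, Finset.sum_mul]
    refine Finset.sum_congr rfl fun χ _ => ?_
    push_cast
    rw [map_mul]
    ring
  rw [Finset.sum_congr rfl hterm, ← Finset.mul_sum, Finset.sum_comm]
  congr 1
  refine Finset.sum_congr rfl fun χ _ => ?_
  rw [Finset.mul_sum]

/-- For `χ` mod `q ≤ P` induced by `χ*` mod `r`: `S(χ, η) = S(χ*, η)` ("`p > P` ensures
`S(χ, η) = S(χ*, η)`", p. 361). [cite: MontgomeryVaughanActa1975, §6 (6.1)] -/
theorem charExpSum_changeLevel {P X : ℝ} {r q : ℕ} [NeZero q] (h : r ∣ q) (hq : 1 ≤ q)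
    (hqP : (q : ℝ) ≤ P) (ψ : DirichletCharacter ℂ r) (η : ℝ) :
    charExpSum P X (DirichletCharacter.changeLevel h ψ) η = charExpSum P X ψ η := by
  unfold charExpSum
  refine Finset.sum_congr rfl fun p hp => ?_
  rw [changeLevel_apply_natCast h ψ, if_pos (coprime_of_mem_primeWindow hp hq hqP)]

/-! ### `∑'_a χ(a) e(am/q) = c_χ(m)` over the reduced residues `1 ≤ a ≤ q` -/

/-- `∑_{0 ≤ a < q} f(a) = ∑_{1 ≤ a ≤ q} f(a)` when `f(0) = f(q)`. [folklore] -/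
theorem sum_range_eq_sum_Icc_of_apply_zero_eq {M : Type*} [AddCommMonoid M] (f : ℕ → M) {q : ℕ}
    (hq : 1 ≤ q) (h : f 0 = f q) : ∑ a ∈ Finset.range q, f a = ∑ a ∈ Finset.Icc 1 q, f a := by
  have h1 : Finset.range q = insert 0 (Finset.Ioo 0 q) := by
    ext a; simp only [Finset.mem_range, Finset.mem_insert, Finset.mem_Ioo]; omega
  have h2 : Finset.Icc 1 q = insert q (Finset.Ioo 0 q) := by
    ext a; simp only [Finset.mem_Icc, Finset.mem_insert, Finset.mem_Ioo]; omega
  rw [h1, h2, Finset.sum_insert (by simp), Finset.sum_insert (by simp), h]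

/-- **`∑_{1≤a≤q, (a,q)=1} χ(a) e(am/q) = c_χ(m)`** (Montgomery–Vaughan 1975, (2.1) and p. 362: the
sum `∑'_a χ(a) e(−na/q) = c_χ(−n)` in (6.4)). [cite: MontgomeryVaughanActa1975, §6 (6.4)] -/
theorem sum_coprime_char_mul_fourierChar {q : ℕ} [NeZero q] (ψ : DirichletCharacter ℂ q) (m : ℤ) :
    ∑ a ∈ (Finset.Icc 1 q).filter (fun a : ℕ => a.Coprime q),
        ψ (a : ZMod q) * (𝐞 ((a : ℝ) * m / q) : ℂ) = charGauss ψ (m : ZMod q) := by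
  have hq : 1 ≤ q := NeZero.one_le
  have h3 : ∀ a : ℕ, (𝐞 ((a : ℝ) * m / q) : ℂ) = ZMod.stdAddChar ((m : ZMod q) * (a : ZMod q)) := by
    intro a
    rw [show (a : ℝ) * m / q = (((a : ℤ) * m : ℤ) : ℝ) / q by push_cast; ring,
      fourierChar_div_eq_stdAddChar']
    push_cast; ring_nf
  -- drop the coprimality condition (`ψ(a) = 0` otherwise), pass to `0 ≤ a < q`, then to `ZMod q`
  have h1 : ∑ a ∈ (Finset.Icc 1 q).filter (fun a : ℕ => a.Coprime q),
      ψ (a : ZMod q) * (𝐞 ((a : ℝ) * m / q) : ℂ) =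
      ∑ a ∈ Finset.Icc 1 q, ψ (a : ZMod q) * (𝐞 ((a : ℝ) * m / q) : ℂ) := by
    rw [Finset.sum_filter]
    refine Finset.sum_congr rfl fun a _ => ?_
    split_ifs with ha
    · rfl
    · rw [MulChar.map_nonunit ψ (mt (ZMod.isUnit_iff_coprime a q).mp ha), zero_mul]
  have h2 : ∑ a ∈ Finset.range q, ψ (a : ZMod q) * (𝐞 ((a : ℝ) * m / q) : ℂ) =
      ∑ a ∈ Finset.Icc 1 q, ψ (a : ZMod q) * (𝐞 ((a : ℝ) * m / q) : ℂ) := by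
    apply sum_range_eq_sum_Icc_of_apply_zero_eq _ hq
    rw [h3, h3]; push_cast; simp
  rw [h1, ← h2, charGauss_eq_sum, ← sum_range_eq_sum_zmod]
  exact Finset.sum_congr rfl fun a _ => by rw [h3]

/-! ### `R₁(n)` as a sum over the individual arcs (the arcs are disjoint for `2P < Q`) -/

/-- Reduced fractions are unique: `a/q = a'/q'` with `(a,q) = (a',q') = 1` forces `q = q'`, `a = a'`.
[folklore] -/
theorem eq_of_coprime_of_mul_eq {a q a' q' : ℕ} (hq : 0 < q) (hq' : 0 < q') (h : a.Coprime q)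
    (h' : a'.Coprime q') (he : a * q' = a' * q) : q = q' ∧ a = a' := by
  have h1 : q ∣ q' := by
    have : q ∣ a * q' := ⟨a', by rw [he]; ring⟩
    exact (Nat.Coprime.symm h).dvd_of_dvd_mul_left this
  have h2 : q' ∣ q := by
    have : q' ∣ a' * q := ⟨a, by rw [← he]; ring⟩
    exact (Nat.Coprime.symm h').dvd_of_dvd_mul_left this
  have hqq : q = q' := Nat.dvd_antisymm h1 h2
  subst hqq
  exact ⟨rfl, Nat.eq_of_mul_eq_mul_right hq he⟩

/-- **Distinct major arcs are disjoint when `2P < Q`**: for reduced `a/q ≠ a'/q'` with `q, q' ≤ P`,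
`|a/q − a'/q'| ≥ 1/(qq') > 1/(qQ) + 1/(q'Q)`. [cite: MontgomeryVaughanActa1975, §2 (2.4)] -/
theorem disjoint_majorArc {P Q : ℝ} (hPQ : 2 * P < Q) {q a q' a' : ℕ} (hq : 1 ≤ q) (hqP : (q : ℝ) ≤ P)
    (hq' : 1 ≤ q') (hq'P : (q' : ℝ) ≤ P) (ha : a.Coprime q) (ha' : a'.Coprime q')
    (hne : (q, a) ≠ (q', a')) : Disjoint (majorArc Q q a) (majorArc Q q' a') := by
  rw [Set.disjoint_iff]
  rintro α ⟨⟨h1, h2⟩, ⟨h3, h4⟩⟩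
  have hq0 : (0 : ℝ) < q := by exact_mod_cast hq
  have hq0' : (0 : ℝ) < q' := by exact_mod_cast hq'
  have hQ : 0 < Q := by linarith [(show (0 : ℝ) ≤ P from le_trans hq0.le hqP)]
  -- `a q' ≠ a' q`
  have hne' : (a : ℤ) * q' - a' * q ≠ 0 := by
    intro h0
    have : a * q' = a' * q := by exact_mod_cast (sub_eq_zero.mp h0)
    obtain ⟨rfl, rfl⟩ := eq_of_coprime_of_mul_eq hq hq' ha ha' this
    exact hne rfl
  have hge : (1 : ℝ) ≤ |(a : ℝ) * q' - a' * q| := by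
    have : (1 : ℤ) ≤ |(a : ℤ) * q' - a' * q| := Int.one_le_abs hne'
    exact_mod_cast this
  -- `|a/q − a'/q'| ≤ 1/(qQ) + 1/(q'Q)`
  have hdiff : |(a : ℝ) / q - a' / q'| ≤ 1 / (q * Q) + 1 / (q' * Q) := by
    rw [abs_le]; constructor <;> linarith
  have hid : (a : ℝ) / q - a' / q' = ((a : ℝ) * q' - a' * q) / (q * q') := by field_simp
  rw [hid, abs_div, abs_of_pos (by positivity : (0 : ℝ) < q * q')] at hdiff
  -- hence `1/(qq') ≤ (q + q')/(qq'Q)`, i.e. `Q ≤ q + q' ≤ 2P`, contradiction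
  have h5 : 1 / ((q : ℝ) * q') ≤ 1 / (q * Q) + 1 / (q' * Q) :=
    le_trans (div_le_div_of_nonneg_right hge (by positivity)) hdiff
  have h6 : Q ≤ q + q' := by
    have := h5
    rw [div_add_div _ _ (by positivity) (by positivity), div_le_div_iff₀ (by positivity) (by positivity)] at this
    nlinarith [mul_pos hq0 hq0', mul_pos (mul_pos hq0 hq0') hQ]
  linarith

/-- The integrand of `R₁` is integrable on any bounded set (it is continuous). [folklore] -/
theorem integrableOn_expSum_sq_mul (P X : ℝ) (n : ℕ) {s : Set ℝ} (hsb : Bornology.IsBounded s) :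
    IntegrableOn (fun α : ℝ => expSum P X α ^ 2 * (𝐞 (-(n * α)) : ℂ)) s volume := by
  obtain ⟨R, hR⟩ := hsb.subset_closedBall 0
  exact ((continuous_expSum_sq_mul P X n).continuousOn.integrableOn_compact
    (isCompact_closedBall (0 : ℝ) R)).mono_set hR

/-- **`R₁(n) = ∑_{q≤P} ∑'_{a} ∫_{𝔐(q,a)} S(α)² e(−nα) dα`** for `2P < Q` (the arcs are then
pairwise disjoint). [cite: MontgomeryVaughanActa1975, §6 (6.4)] -/
theorem majorArcIntegral_eq_sum {P Q : ℝ} (hPQ : 2 * P < Q) (hP : 0 ≤ P) (X : ℝ) (n : ℕ) :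
    majorArcIntegral P Q X n =
      ∑ q ∈ Finset.Icc 1 ⌊P⌋₊, ∑ a ∈ (Finset.Icc 1 q).filter (fun a : ℕ => a.Coprime q),
        ∫ α in majorArc Q q a, expSum P X α ^ 2 * (𝐞 (-(n * α)) : ℂ) := by
  have hqP : ∀ q ∈ Finset.Icc 1 ⌊P⌋₊, 1 ≤ q ∧ (q : ℝ) ≤ P := fun q hq => by
    rw [Finset.mem_Icc] at hq
    exact ⟨hq.1, (Nat.cast_le.mpr hq.2).trans (Nat.floor_le hP)⟩
  have hint : ∀ q a : ℕ, IntegrableOn (fun α : ℝ => expSum P X α ^ 2 * (𝐞 (-(n * α)) : ℂ))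
      (majorArc Q q a) volume := fun q a =>
    integrableOn_expSum_sq_mul P X n (Metric.isBounded_Icc _ _)
  rw [majorArcIntegral, majorArcs]
  rw [integral_biUnion_finset]
  · refine Finset.sum_congr rfl fun q hq => ?_
    refine integral_biUnion_finset _ (fun a _ => measurableSet_Icc) ?_ (fun a _ => hint q a)
    intro a ha a' ha' hne
    rw [Finset.coe_filter, Set.mem_setOf_eq, Finset.mem_Icc] at ha ha'
    exact disjoint_majorArc hPQ (hqP q hq).1 (hqP q hq).2 (hqP q hq).1 (hqP q hq).2 ha.2 ha'.2
      (fun h => hne (Prod.ext_iff.mp h).2)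
  · exact fun q _ => MeasurableSet.biUnion (Finset.countable_toSet _) fun _ _ => measurableSet_Icc
  · intro q hq q' hq' hne
    simp only [Function.onFun, Set.disjoint_iUnion_left, Set.disjoint_iUnion_right]
    intro a' ha' a ha
    rw [Finset.mem_filter, Finset.mem_Icc] at ha ha'
    exact disjoint_majorArc hPQ (hqP q hq).1 (hqP q hq).2 (hqP q' hq').1 (hqP q' hq').2 ha.2 ha'.2
      (fun h => hne (Prod.ext_iff.mp h).1)
  · intro q _
    exact integrableOn_finset_iUnion.2 fun a _ => hint q a

/-- **Translation to the centre of the arc**: `∫_{𝔐(q,a)} F(α) dα = ∫_{−1/(qQ)}^{1/(qQ)} F(a/q + η) dη`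
(`0 < qQ`). [cite: MontgomeryVaughanActa1975, §6 (6.1)] -/
theorem integral_majorArc_eq (F : ℝ → ℂ) {Q : ℝ} {q : ℕ} (hqQ : 0 < (q : ℝ) * Q) (a : ℕ) :
    ∫ α in majorArc Q q a, F α = ∫ η in (-(1 / (q * Q)))..(1 / (q * Q)), F ((a : ℝ) / q + η) := by
  have hh : 0 < 1 / ((q : ℝ) * Q) := by positivity
  rw [majorArc, integral_Icc_eq_integral_Ioc, ← intervalIntegral.integral_of_le (by linarith),
    intervalIntegral.integral_comp_add_left F ((a : ℝ) / q)]
  congr 1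

/-! ### (6.3)–(6.4): squaring and summing over `a` -/

/-- Pointwise form of (6.3): `S(a/q+η)² e(−n(a/q+η)) = φ(q)⁻² ∑_{χ,χ'} χχ'(a) e(−na/q) τ(χ̄)τ(χ̄')
S(χ,η) S(χ',η) e(−nη)`. [cite: MontgomeryVaughanActa1975, §6 (6.3)] -/
theorem expSum_sq_mul_majorArc_eq {P X : ℝ} {q : ℕ} [NeZero q] (hq : 1 ≤ q) (hqP : (q : ℝ) ≤ P)
    {a : ℕ} (ha : a.Coprime q) (n : ℕ) (η : ℝ) :
    expSum P X ((a : ℝ) / q + η) ^ 2 * (𝐞 (-(n * ((a : ℝ) / q + η))) : ℂ) =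
      ((q.totient : ℂ)⁻¹) ^ 2 * ∑ χ : DirichletCharacter ℂ q, ∑ χ' : DirichletCharacter ℂ q,
        ((χ * χ') (a : ZMod q) * (𝐞 ((a : ℝ) * ((-(n : ℤ) : ℤ) : ℝ) / q) : ℂ)) *
          (gaussSum χ⁻¹ ZMod.stdAddChar * gaussSum χ'⁻¹ ZMod.stdAddChar *
            (charExpSum P X χ η * charExpSum P X χ' η * (𝐞 (-(n * η)) : ℂ))) := by
  rw [expSum_majorArc_eq hq hqP ha η]
  have he : (𝐞 (-(n * ((a : ℝ) / q + η))) : ℂ) = (𝐞 ((a : ℝ) * ((-(n : ℤ) : ℤ) : ℝ) / q) : ℂ) * (𝐞 (-(n * η)) : ℂ) := by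
    rw [← Circle.coe_mul, ← AddChar.map_add_eq_mul]
    congr 2; push_cast; ring
  rw [he, mul_pow, sq (∑ χ : DirichletCharacter ℂ q, _), Finset.sum_mul_sum, mul_assoc, Finset.sum_mul]
  congr 1
  refine Finset.sum_congr rfl fun χ _ => ?_
  rw [Finset.sum_mul]
  refine Finset.sum_congr rfl fun χ' _ => ?_
  rw [MulChar.mul_apply]
  ring

/-- Continuity of the integrands `S(χ,η) S(χ',η) e(−nη)`. [folklore] -/
theorem continuous_charExpSum_mul (P X : ℝ) {q : ℕ} (χ χ' : DirichletCharacter ℂ q) (n : ℕ) :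
    Continuous fun η : ℝ => charExpSum P X χ η * charExpSum P X χ' η * (𝐞 (-(n * η)) : ℂ) := by
  unfold charExpSum; fun_prop

/-- **(6.4), general form** (before splitting `S(χ, η) = T + W`): for `1 ≤ q ≤ P`,
`∑'_a ∫_{−h}^{h} S(a/q+η)² e(−n(a/q+η)) dη = φ(q)⁻² ∑_{χ,χ'} c_{χχ'}(−n) τ(χ̄) τ(χ̄')
∫_{−h}^{h} S(χ,η) S(χ',η) e(−nη) dη`. [cite: MontgomeryVaughanActa1975, §6 (6.4)] -/
theorem sum_coprime_integral_expSum_sq_eq {P X : ℝ} {q : ℕ} [NeZero q] (hq : 1 ≤ q)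
    (hqP : (q : ℝ) ≤ P) (n : ℕ) (h : ℝ) :
    ∑ a ∈ (Finset.Icc 1 q).filter (fun a : ℕ => a.Coprime q),
        ∫ η in (-h)..h, expSum P X ((a : ℝ) / q + η) ^ 2 * (𝐞 (-(n * ((a : ℝ) / q + η))) : ℂ) =
      ((q.totient : ℂ)⁻¹) ^ 2 * ∑ χ : DirichletCharacter ℂ q, ∑ χ' : DirichletCharacter ℂ q,
        charGauss (χ * χ') ((-(n : ℤ) : ℤ) : ZMod q) *
          (gaussSum χ⁻¹ ZMod.stdAddChar * gaussSum χ'⁻¹ ZMod.stdAddChar *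
            ∫ η in (-h)..h, charExpSum P X χ η * charExpSum P X χ' η * (𝐞 (-(n * η)) : ℂ)) := by
  set I : DirichletCharacter ℂ q → DirichletCharacter ℂ q → ℂ := fun χ χ' =>
    ∫ η in (-h)..h, charExpSum P X χ η * charExpSum P X χ' η * (𝐞 (-(n * η)) : ℂ) with hI
  set τ' : DirichletCharacter ℂ q → ℂ := fun χ => gaussSum χ⁻¹ ZMod.stdAddChar with hτ'
  -- each arc integral, by (6.3), termwise
  have hstep : ∀ a ∈ (Finset.Icc 1 q).filter (fun a : ℕ => a.Coprime q),
      ∫ η in (-h)..h, expSum P X ((a : ℝ) / q + η) ^ 2 * (𝐞 (-(n * ((a : ℝ) / q + η))) : ℂ) =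
      ((q.totient : ℂ)⁻¹) ^ 2 * ∑ χ : DirichletCharacter ℂ q, ∑ χ' : DirichletCharacter ℂ q,
        ((χ * χ') (a : ZMod q) * (𝐞 ((a : ℝ) * ((-(n : ℤ) : ℤ) : ℝ) / q) : ℂ)) * (τ' χ * τ' χ' * I χ χ') := by
    intro a ha
    rw [Finset.mem_filter] at ha
    have hii : ∀ χ χ' : DirichletCharacter ℂ q, IntervalIntegrable (fun η : ℝ =>
        ((χ * χ') (a : ZMod q) * (𝐞 ((a : ℝ) * ((-(n : ℤ) : ℤ) : ℝ) / q) : ℂ)) *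
          (τ' χ * τ' χ' * (charExpSum P X χ η * charExpSum P X χ' η * (𝐞 (-(n * η)) : ℂ))))
        volume (-h) h := fun χ χ' =>
      (((continuous_charExpSum_mul P X χ χ' n).const_mul _).const_mul _).intervalIntegrable _ _
    simp_rw [expSum_sq_mul_majorArc_eq hq hqP ha.2 n]
    rw [intervalIntegral.integral_const_mul]
    congr 1
    have hcs : ∀ χ : DirichletCharacter ℂ q, IntervalIntegrable (fun η : ℝ => ∑ χ' : DirichletCharacter ℂ q,
        ((χ * χ') (a : ZMod q) * (𝐞 ((a : ℝ) * ((-(n : ℤ) : ℤ) : ℝ) / q) : ℂ)) *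
          (τ' χ * τ' χ' * (charExpSum P X χ η * charExpSum P X χ' η * (𝐞 (-(n * η)) : ℂ))))
        volume (-h) h := fun χ =>
      (continuous_finsetSum _ fun χ' _ =>
        ((continuous_charExpSum_mul P X χ χ' n).const_mul _).const_mul _).intervalIntegrable _ _
    rw [intervalIntegral.integral_finsetSum fun χ _ => hcs χ]
    refine Finset.sum_congr rfl fun χ _ => ?_
    rw [intervalIntegral.integral_finsetSum fun χ' _ => hii χ χ']
    refine Finset.sum_congr rfl fun χ' _ => ?_
    rw [intervalIntegral.integral_const_mul, intervalIntegral.integral_const_mul]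
  rw [Finset.sum_congr rfl hstep, ← Finset.mul_sum]
  congr 1
  rw [Finset.sum_comm]
  refine Finset.sum_congr rfl fun χ _ => ?_
  rw [Finset.sum_comm]
  refine Finset.sum_congr rfl fun χ' _ => ?_
  rw [← Finset.sum_mul, sum_coprime_char_mul_fourierChar (χ * χ') (-(n : ℤ))]

end Literature.NumberTheory.Sieve.MontgomeryVaughan1975
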